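import Summits.Ventures.CertifiedManyBodySolver.Observables.StiffnessTLKineticTTOrbitDictionary
import Summits.Ventures.CertifiedManyBodySolver.Observables.StiffnessTLKineticCeilingURay
import Summits.Ventures.CertifiedManyBodySolver.Observables.RungLeavesStiffnessAnchor
import HarnessLib

/-!
# Ventures/CertifiedManyBodySolver — Observables/StiffnessOddMomentURay.lean

HONEST FRAMING: bookkeeping for one-sided certified stiffness CEILINGS — the U-RAY («parameter half-line», D-0042 R2(e)) form of the
`t′ = 0` f-sum edge when it is certified in the ODD-MOMENT / kinx NODE SHAPE `SquareTTPrimeCorrOrbitLowerRow 0 U₀ n u r univ (box 2 7)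
(−oddMomentObsTT 0 U₀ 0)` (the T2 / OBS-2 menu-mode «kinx» cells of obs-lit's emitter; the EXT5-class `kinWord` shape already has
`ObsStiffnessSeqCeilingAt_tp0_on_ray_of_kinWord_orbitLowerRow`, p2 g9). Zero compute, no definition, no claim node. A ceiling never speaks to
the presence of order; not informative vs print; not a superconductivity verdict.

Cell `hubbard-obs` (D-0042), seat p2 (stiffness), `prover-hubbard-obs-p2-g13-0`. Chain (all in tree): the orbit row bounds the `D₄`-orbit mean of
the `λ = 0` functional by `−r` (`orbitMean_oddMomentTT_lam_zero_le_neg_of_orbitLowerRow`, p451558); at `t′ = 0` that orbit mean is `−¼·k(ω)`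
(`orbitMean_rotOddMomentLimitFunctionalTT_lam_zero_eq_meanEnergy_twice_tPrime` + `meanEnergy_hubbardTTPrime_oneBody_eq_kineticDensity`), so
`−k(ω) ≤ −4r` on the `(U₀, n, 0)` torus-limit ground-state class; the U-ray transport (`⟨−T⟩` non-increasing in `U`,
`ObsStiffnessSeqCeilingAt_tp0_on_ray_of_forall_negKinetic_le`, p434970/p440587) then gives the robust leaf `ObsStiffnessSeqCeilingAt 0 U n c` for
EVERY `U ≥ U₀` and every rational `c ≥ −r`.

* `forall_torusLimit_negKinetic_le_of_oddMomentTT_orbitLowerRow_tp0` — the kinetic reading `−k(ω) ≤ −4r` of a `t′ = 0` kinx node.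
* `ObsStiffnessSeqCeilingAt_tp0_on_ray_of_oddMomentTT_orbitLowerRow_univ` — **∀ U ≥ U₀: `ObsStiffnessSeqCeilingAt 0 U n c`** (`c ≥ −r`).

References: D. J. Scalapino, S. R. White, S.-C. Zhang, PRB 47 (1993) 7995, §II [ScalapinoWhiteZhang1993]; T. Koma, H. Tasaki, J. Stat. Phys.
76 (1994) 745, §1 [KomaTasaki1994].
-/

noncomputable section

namespace Summit.Ventures.CertifiedManyBodySolver.Observables

open Literature.MathematicalPhysics.QuantumLattice
open Literature.MathematicalPhysics.QuantumLattice.ThermodynamicLimit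
open Literature.Probability.LatticeModels
open Matrix Finset Filter Topology
open scoped Matrix BigOperators ComplexOrder

/-- **Kinetic reading of a `t′ = 0` odd-moment (λ = 0) orbit lower row.** If the `D₄`-orbit lower row
`SquareTTPrimeCorrOrbitLowerRow 0 U n u r univ (box 2 7) (−oddMomentObsTT 0 U 0)` holds and `e₀(U, n, 0) ≤ u`, then for every torus limit `ω`
of unit `(rectN n L, S^z = 0)`-sector ground states of `hubbardTorusTT' L 1 0 U`: `−k(ω) ≤ −4r` (`k` = the x+y nearest-neighbour hopping energy per
site). [cite: ScalapinoWhiteZhang1993, §II] -/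
theorem forall_torusLimit_negKinetic_le_of_oddMomentTT_orbitLowerRow_tp0 {U n : ℝ} {u r : ℚ}
    (hrow : SquareTTPrimeCorrOrbitLowerRow 0 U n u r Finset.univ (box 2 7) (-oddMomentObsTT 0 U 0))
    (hu : energyDensityTT' 1 0 U n ≤ ((u : ℚ) : ℝ)) :
    ∀ (ω : InfVolFermionState 2) (Ls : ℕ → ℕ) (ψ : ∀ L, Fock (Orb (FermionTorus 2 L))),
      Tendsto Ls atTop atTop →
      (∀ j, IsGroundStateInSector (hubbardTorusTT' (Ls j) 1 0 U) (rectN n (Ls j)) 0 (ψ (Ls j))) →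
      (∀ j, star (ψ (Ls j)) ⬝ᵥ ψ (Ls j) = 1) → ω.IsTorusLimitOf ψ Ls →
      -(∑ i : Fin 2, -(1 : ℝ) * ∑ σ : Fin 2,
          ((ω.expect {0, 0 + unitVec i}
              ((cAt 0 (mem_insert_self _ _) σ)ᴴ * cAt (0 + unitVec i) (mem_insert_of_mem (mem_singleton_self _)) σ)).re +
            (ω.expect {0, 0 + unitVec i}
              ((cAt (0 + unitVec i) (mem_insert_of_mem (mem_singleton_self _)) σ)ᴴ * cAt 0 (mem_insert_self _ _) σ)).re)) ≤
        -4 * ((r : ℚ) : ℝ) := by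
  intro ω Ls ψ hLs hψ h1 hω
  have h := orbitMean_oddMomentTT_lam_zero_le_neg_of_orbitLowerRow 0 hrow hu ω Ls ψ hLs hψ h1 hω
  rw [orbitMean_rotOddMomentLimitFunctionalTT_lam_zero_eq_meanEnergy_twice_tPrime hω.isTranslationInvariant 0 U,
    show (2 : ℝ) * 0 = 0 by norm_num, meanEnergy_hubbardTTPrime_oneBody_eq_kineticDensity hω.isTranslationInvariant] at h
  linarith

/-- **U-RAY LEAF from a `t′ = 0` kinx / odd-moment node (λ = 0).** `0 ≤ U₀ ≤ U`, `0 ≤ n < 2`; an orbit lower row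
`SquareTTPrimeCorrOrbitLowerRow 0 U₀ n u r univ (box 2 7) (−oddMomentObsTT 0 U₀ 0)` with a certified cap `e₀(U₀, n, 0) ≤ u` gives, for every rational
`c ≥ −r`, the robust stiffness leaf `ObsStiffnessSeqCeilingAt 0 U n c` AT EVERY COUPLING `U ≥ U₀` on the `(n, 0)` ray (a half-line certificate from a
point certificate; at `U = U₀` this is `ObsStiffnessSeqCeilingAt_of_oddMomentTT_orbitLowerRow_univ` at `λ = 0`). [cite: KomaTasaki1994, §1]
[cite: ScalapinoWhiteZhang1993, §II] -/
theorem ObsStiffnessSeqCeilingAt_tp0_on_ray_of_oddMomentTT_orbitLowerRow_univ {U₀ U n : ℝ} {u r : ℚ} (hU₀ : 0 ≤ U₀) (hU : U₀ ≤ U)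
    (hn0 : 0 ≤ n) (hn2 : n < 2)
    (hrow : SquareTTPrimeCorrOrbitLowerRow 0 U₀ n u r Finset.univ (box 2 7) (-oddMomentObsTT 0 U₀ 0))
    (hu : energyDensityTT' 1 0 U₀ n ≤ ((u : ℚ) : ℝ)) (c : ℚ) (hc : -r ≤ c) :
    ObsStiffnessSeqCeilingAt 0 U n c := by
  have hc' : -((r : ℚ) : ℝ) ≤ ((c : ℚ) : ℝ) := by exact_mod_cast hc
  exact ObsStiffnessSeqCeilingAt_tp0_on_ray_of_forall_negKinetic_le hU₀ hU hn0 hn2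
    (forall_torusLimit_negKinetic_le_of_oddMomentTT_orbitLowerRow_tp0 hrow hu) c (by linarith)

end Summit.Ventures.CertifiedManyBodySolver.Observables

end
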